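import Summits.SmoothPoincare4.SmoothPoincare4.Theses.ZeroSurgeryExotic
import Literature.Topology.FourManifolds.GaussDiagram16n68278
import Literature.Topology.FourManifolds.SliceRibbonIsotopyProofs
import HarnessLib

/-!
# Line `table-eleven-cell` for crux `ZeroSurgeryExotic.ZseThesis` (stmt-SmoothPoincare4-0364) — the bare named cell

Strategist line (planner-cstrat-stmt-SmoothPoincare4-0364-h1-0, 2026-08-17; crux idea
`Ideas/table-eleven-bare-cell.md`, census `STRATEGY-CENSUS.md` §Strengthen S3, sketch
`StrategistSketch.lean`). An ALTERNATIVE to the lead's line `Lines/Sketch.lean`, not a replacement: the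
two lines share no stub.

## The crux

`ZseThesis : ∃ K K' Y, IsIntegralSurgery (𝓡 3) Y K 0 ∧ IsIntegralSurgery (𝓡 3) Y K' 0 ∧ K.IsSmoothlySlice ∧
¬ K'.IsSmoothlySlice` — a smoothly slice knot with a `0`-friend that is not smoothly slice (the route's
target; with the PROVED `Assembly` a proof is a Lean disproof of `SmoothPoincare4`).

## The line in one paragraph

Dunfield–Gong, *Ribbon concordances and slice obstructions* (arXiv:2512.21825, 2025), Thm 5.14 (p. 47) with
Table 11 (p. 48): the census knot `16n68278` (16 crossings, `Δ = 1`, every computed obstruction vanishes —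
a "mystery knot", §5.13) has a `0`-friend `K'`, presented by the super-special RBG link with DT code
`tcbjhTDJBgQmsOLhPcekIRFnA`, `r = 1` (certified common `0`-surgery, §5.11), with LEO invariant
`s̃_c(K') ≠ 0` (Dunfield–Lipshitz–Schütz) — hence `K'` is NOT smoothly slice — while `s_F(K') = 0` for
every field is forced (else Thm 5.9 would have decided `16n68278`). "If `16n68278` is smoothly slice,
there is an exotic smooth 4-sphere." This is the ONLY kind of live printed cell of the zero-surgery
programme, and it is invisible to every `s`-typed statement (the sibling crux 0366, the lead's `stub_hit`).
The knot is now DATA in the tree: `gaussDiagram16n68278 : GaussDiagram` (SnapPy `K16n68278`, DT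
`papbdgaHNJclMFoPKEi`, transcription `decide`-checked against the DT and PD codes; p147216).
THE TYPING MOVE: quantify the partner EXISTENTIALLY and state its non-sliceness BARE
(`¬ IsSmoothlySlice`), so that the refined (LEO) tier — for which the tree has no vocabulary — enters only
the eventual PROOF of stub 1, never a statement. Three stubs, all over existing declarations:

* `stub_realisedRow` — the Table-11 row as a statement about the code: SOME knot reading
  `gaussDiagram16n68278` has a `0`-friend that is not smoothly slice (realisation of SnapPy's planar
  diagram + DG's certified homeomorphism + `s̃_c(K') ≠ 0` + "refined `s`-invariants vanish on slice
  knots"). A computer-assisted THEOREM in print; XL to formalise (named-fact-instance candidate).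
* `stub_codeRigid` — a realised signed Gauss code determines the knot type: any two knots reading
  `gaussDiagram16n68278` are isotopic (Goussarov–Polyak–Viro Thm 1.B / Reidemeister; the instance of the
  tree's named fact `Knot.reidemeister`, calibrated below). KNOWN; L.
* `stub_cellB` — THE BET: some knot reading `gaussDiagram16n68278` is smoothly slice (= the hypothesis of
  DG Thm 5.14; a ribbon disc is a finite certificate, `cellB_of_isRibbon`). OPEN; a YES is an exotic `S⁴`.

`ZseThesis_of`: the slice reader `K` (stub 3) is isotopic (stub 2) to the realised knot `K₀` (stub 1), so
`K₀` is slice (`Knot.IsSmoothlySlice.of_isIsotopic_holds`, PROVED), and `(K₀, K', Y)` is a witness.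

## Why it dodges the stuck goal of `Sketch`

`Sketch` is stuck on (i) `stub_hit` — an UNPINNED `s`-typed search that cannot use the Table-11 cells
(`s_F(K') = 0` there) and has no knot software on hub or farm — and (ii) `stub_sliceVanishing` ⟺ Rasmussen's
Theorem 1 for ALL knots (link Gauss diagrams, Morse-move Lee maps, movie genericity: absent). Here (i) is
replaced by ONE sliceness question about ONE explicit 16-crossing knot whose partner side is settled in
print, and (ii) disappears: no `s`, no soundness theorem over all knots — the obstruction is consumed as the
published fact about one named partner inside stub 1.

## Disproof used (`Cruxes/ZseThesis/Disproof.lean`, cdisprove gen 1 v3; read 2026-08-17)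

* no `_false_without_<H>` theorem; §4 load-bearing deletions + §2 `zseThesis_without_nonslice`: all four
  conjuncts delivered — common `Y` ×2 and `¬slice(K')` by stub 1, `slice(K₀)` by stubs 3 + 2.
* §3/§3d dead witness shapes (`K' = K`, isotopic, mirror, reverse, inverse, concordant): honoured by the
  data — `s̃_c(K') ≠ 0` while every computed obstruction of `16n68278` vanishes (DG §5.13), so `K'` is not
  concordant to `K₀` nor to a symmetric image of it.
* §3b certification barrier (`zseThesis_hballWitness_false`, `zseThesis_topWitness_false_of_freedman`): `K'`
  IS homotopy-ball slice and topologically slice; `s̃_c` is smooth-only, Khovanov-type — the admissible kind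
  §3b itself names (`s, s_F, LEO s̃_c`).
* §6b price (`zseThesis_cost_nearMiss`): accepted — a ribbon certificate for `16n68278` makes the MP sphere
  geometrically simply connected; a YES also refutes `NoohGscStandard` (0377).
* §7 "where not to look" (families where `s` is forced to vanish): this line sits INSIDE DG Thm 5.9's
  family on purpose, with a bare conclusion for which nothing is forced; §8 framing `0` both sides.
* No landed Negative lemma (`Theorems/ZseThesis/Negative/{Position,ReverseClosure,UnknotSeed}`,
  `ZseSVanishesOnPairs/Negative/*`) refutes an instance (they concern `s`, symmetric partners, the unknot).

## Typing policy

Everything over existing declarations: `Knot`, `Knot.HasGaussDiagram`, `gaussDiagram16n68278`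
(`GaussDiagram16n68278.lean`), `IsIntegralSurgery` (`DehnSurgery.lean`), `Knot.IsSmoothlySlice`,
`Knot.IsRibbon` (`SliceRibbon.lean`), `SphereEmbedding.IsIsotopic`, `Knot.reidemeister` (named fact, used only
in the calibration lemma). No definition is introduced. Exactly one theorem concludes the crux.
-/

noncomputable section

-- the prescribed namespace `Summit.<P>.<Sub>.…` duplicates `SmoothPoincare4` (P = Sub)
set_option linter.dupNamespace false

open scoped Manifold ContDiff
open Set Function
open Literature.Topology.FourManifolds
open Summit.SmoothPoincare4.SmoothPoincare4.Theses.ZeroSurgeryExotic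

namespace Summit.SmoothPoincare4.SmoothPoincare4.Cruxes.ZseThesis.TableElevenCell

/-- Local notation: `𝔼 n` is `EuclideanSpace ℝ (Fin n)`. -/
local notation "𝔼 " n:arg => EuclideanSpace ℝ (Fin n)

/-! ### The stubs -/

/-- **stub 1 (the Table-11 row, a computer-assisted theorem in print; XL).** Some knot `K₀` reading the
signed Gauss code `gaussDiagram16n68278` (SnapPy's `K16n68278`, DT `papbdgaHNJclMFoPKEi`; the code is
planar, so a reader exists) has a `0`-friend `K'` — a 3-manifold `Y` that is `0`-surgery on both — which is
NOT smoothly slice. In print: the super-special RBG link `L = R ∪ B ∪ G` with DT code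
`tcbjhTDJBgQmsOLhPcekIRFnA`, `r = 1`, `b = g = 0` presents the pair (`K_B`, `K_G`) = (`16n68278`, `K'`) up
to the roles of `B`/`G`, with common `0`-surgery `S³_{r,0,0}(L)` (Dunfield–Gong Def 5.7, §5.11, Table 11
p. 48; Manolescu–Piccirillo Thm 1.2); `s̃_c(K') ≠ 0` (Table 11, a KnotJob computation of the
Dunfield–Lipshitz–Schütz LEO invariant), and refined `s`-invariants vanish on smoothly slice knots
(Lipshitz–Sarkar 2014 Thm 1; DLS §6). Mirror-robust: the DT code fixes the knot up to mirror image, and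
"has a non-slice `0`-friend" is mirror-invariant (mirror the whole configuration). Why it might fail: only
by a transcription/identification error between SnapPy's `K16n68278` and DG's `16n68278` (numbering
cross-checked through DG Tables 3/4 volumes in `GaussDiagram16n68278.lean`) or an error in the published
certified computation. Formal route: realisation of the PD code as a smooth knot + Kirby calculus for `L` +
LEO theory — realistically a named-fact instance. [cite: DunfieldGong2025, Thm. 5.14 and Table 11] -/
theorem stub_realisedRow :
    ∃ K₀ : Knot, K₀.HasGaussDiagram gaussDiagram16n68278 ∧
      ∃ (K' : Knot) (Y : Type) (_ : TopologicalSpace Y) (_ : ChartedSpace (𝔼 3) Y),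
        IsIntegralSurgery (𝓡 3) Y K₀ 0 ∧ IsIntegralSurgery (𝓡 3) Y K' 0 ∧ ¬ K'.IsSmoothlySlice := by
  sorry

/-- **stub 2 (code rigidity; KNOWN, L).** Any two knots whose stereographic projections read the signed
Gauss code `gaussDiagram16n68278` are (ambient) isotopic: a realised signed Gauss diagram determines the
knot type (Goussarov–Polyak–Viro 2000 Thm 1.B; Reidemeister 1927). It is the instance `G = G' =
gaussDiagram16n68278` of the tree's named fact `Knot.reidemeister` (`stub_codeRigid_of_reidemeister`);
a direct proof for one diagram needs the same isotopy-construction technology. Why it might fail: it cannot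
(theorem in print); the risk is only formalisation size. [cite: GPV2000, Thm. 1.B] -/
theorem stub_codeRigid :
    ∀ K K₀ : Knot, K.HasGaussDiagram gaussDiagram16n68278 → K₀.HasGaussDiagram gaussDiagram16n68278 →
      K.IsIsotopic K₀ := by
  sorry

/-- **stub 3 (THE BET; open problem — a YES is an exotic `S⁴`).** Some knot reading `gaussDiagram16n68278`
is smoothly slice, i.e. `16n68278` is slice (the hypothesis of Dunfield–Gong Thm 5.14; all its computed
obstructions vanish: `Δ = 1` so topologically slice, `s` over ℚ/𝔽₂/𝔽₃, odd `Sq¹`, LEO `s̃_c`, `sl₃`-`s`,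
`τ/ν/ε` all zero, DG §4–§5.13). The practical certificate is a ribbon disc (`cellB_of_isRibbon`): band
attachments on the 16-crossing diagram or on any diagram of an isotopic knot, symmetric-union and
0-trace-mate ansätze (Kegel–Spreer 2026 §6). Why it might fail: `16n68278` may simply not be slice —
Dunfield–Gong's band engine (which certified > 42 % of their 1.1 M-knot sample ribbon) found no disc, and a
class-0 refined vanishing theorem ("biprojectively H-slice ⇒ `s̃_c = 0`") would prove it non-slice (Ren 2025
shows the known sandwich proof cannot deliver this for odd/`Sq²`-type refinements). Size: open problem.
[cite: DunfieldGong2025, Thm. 5.14 and §5.13] -/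
theorem stub_cellB :
    ∃ K : Knot, K.HasGaussDiagram gaussDiagram16n68278 ∧ K.IsSmoothlySlice := by
  sorry

/-! ### The composition -/

/-- **The line closes the crux.** Take the realised knot `K₀` with its non-slice `0`-friend `K'` and common
`0`-surgery `Y` (stub 1) and a smoothly slice reader `K` of the same code (stub 3); `K` is isotopic to `K₀`
(stub 2), so `K₀` is smoothly slice (sliceness is an isotopy invariant — `Knot.IsSmoothlySlice.of_isIsotopic_holds`,
PROVED in `SliceRibbonIsotopyProofs`); `(K₀, K', Y)` witnesses `ZseThesis`. [cite: DunfieldGong2025, Thm. 5.14] -/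
theorem ZseThesis_of : ZseThesis := by
  obtain ⟨K₀, h₀, K', Y, _, _, h1, h2, hK'⟩ := stub_realisedRow
  obtain ⟨K, hK, hKs⟩ := stub_cellB
  exact ⟨K₀, K', Y, _, _, h1, h2,
    Knot.IsSmoothlySlice.of_isIsotopic_holds (stub_codeRigid K K₀ hK h₀) hKs, hK'⟩

/-! ### Calibration and by-products (none concludes the crux) -/

/-- **Stub 2 is an instance of the named fact `Knot.reidemeister`** (GPV Thm 1.B in Gauss-diagram form):
knots with a common Gauss diagram are isotopic (`Knot.HasGaussDiagram.isIsotopic`). So stub 2 is at most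
as hard as the tree's standing Reidemeister debt, which the lead's `stub_sliceVanishing` also carries.
[cite: GPV2000, Thm. 1.B] -/
theorem stub_codeRigid_of_reidemeister (hR : Knot.reidemeister) :
    ∀ K K₀ : Knot, K.HasGaussDiagram gaussDiagram16n68278 → K₀.HasGaussDiagram gaussDiagram16n68278 →
      K.IsIsotopic K₀ :=
  fun _ _ hK h₀ ↦ Knot.HasGaussDiagram.isIsotopic hR hK h₀

/-- **A ribbon certificate settles the bet**: if some knot reading the code is ribbon, stub 3 holds
(`Knot.IsRibbon.isSmoothlySlice`, PROVED). This is the form in which a band search delivers stub 3.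
[cite: DunfieldGong2025, §2 (ribbon certificates)] -/
theorem cellB_of_isRibbon {K : Knot} (hK : K.HasGaussDiagram gaussDiagram16n68278) (hr : K.IsRibbon) :
    ∃ K : Knot, K.HasGaussDiagram gaussDiagram16n68278 ∧ K.IsSmoothlySlice :=
  ⟨K, hK, hr.isSmoothlySlice⟩

/-- **Stubs 1 + 2 say: EVERY reader of the code has a non-slice `0`-friend** (the universal "Cell A" of the
strategist sketch) — by transporting the `0`-surgery along the isotopy to the realised knot
(`IsIntegralSurgery.of_isIsotopic` is a named fact of `DehnSurgery.lean`, discharged in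
`KirbyMovesIsotopyProofs`; taken here as a hypothesis to keep this file's import cone small).
[cite: DunfieldGong2025, Thm. 5.14 and Table 11] -/
theorem cellA_of_stubs
    (hT : ∀ {Y : Type} [TopologicalSpace Y] [ChartedSpace (𝔼 3) Y],
      IsIntegralSurgery.of_isIsotopic (IY := 𝓡 3) (Y := Y))
    (h1 : ∃ K₀ : Knot, K₀.HasGaussDiagram gaussDiagram16n68278 ∧
      ∃ (K' : Knot) (Y : Type) (_ : TopologicalSpace Y) (_ : ChartedSpace (𝔼 3) Y),
        IsIntegralSurgery (𝓡 3) Y K₀ 0 ∧ IsIntegralSurgery (𝓡 3) Y K' 0 ∧ ¬ K'.IsSmoothlySlice)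
    (h2 : ∀ K K₀ : Knot, K.HasGaussDiagram gaussDiagram16n68278 →
      K₀.HasGaussDiagram gaussDiagram16n68278 → K.IsIsotopic K₀) :
    ∀ K : Knot, K.HasGaussDiagram gaussDiagram16n68278 →
      ∃ (K' : Knot) (Y : Type) (_ : TopologicalSpace Y) (_ : ChartedSpace (𝔼 3) Y),
        IsIntegralSurgery (𝓡 3) Y K 0 ∧ IsIntegralSurgery (𝓡 3) Y K' 0 ∧ ¬ K'.IsSmoothlySlice := by
  intro K hK
  obtain ⟨K₀, h₀, K', Y, _, _, hY₀, hY', hK'⟩ := h1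
  exact ⟨K', Y, _, _, hT hY₀ (h2 K₀ K h₀ hK), hY', hK'⟩

/-- **A YES disproves the summit** through the route's assembly decl `Assembly` (PROVED in
`Theorems/ZeroSurgeryExoticAssembly.lean`; taken here as the registered route obligation it is).
[cite: DunfieldGong2025, Thm. 5.14] -/
theorem not_smoothPoincare4_of_stubs (hA : Assembly)
    (h1 : ∃ K₀ : Knot, K₀.HasGaussDiagram gaussDiagram16n68278 ∧
      ∃ (K' : Knot) (Y : Type) (_ : TopologicalSpace Y) (_ : ChartedSpace (𝔼 3) Y),
        IsIntegralSurgery (𝓡 3) Y K₀ 0 ∧ IsIntegralSurgery (𝓡 3) Y K' 0 ∧ ¬ K'.IsSmoothlySlice)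
    (h2 : ∀ K K₀ : Knot, K.HasGaussDiagram gaussDiagram16n68278 →
      K₀.HasGaussDiagram gaussDiagram16n68278 → K.IsIsotopic K₀)
    (h3 : ∃ K : Knot, K.HasGaussDiagram gaussDiagram16n68278 ∧ K.IsSmoothlySlice) :
    ¬ _root_.SmoothPoincare4 := by
  obtain ⟨K₀, h₀, K', Y, _, _, hY₀, hY', hK'⟩ := h1
  obtain ⟨K, hK, hKs⟩ := h3
  exact hA ⟨K₀, K', Y, _, _, hY₀, hY',
    Knot.IsSmoothlySlice.of_isIsotopic_holds (h2 K K₀ hK h₀) hKs, hK'⟩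

end Summit.SmoothPoincare4.SmoothPoincare4.Cruxes.ZseThesis.TableElevenCell

end
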